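import Literature.MathematicalPhysics.QuantumFieldTheory.Balaban1983to89.B1Eq335GeneratingFunction

/-!
# `Balaban1983to89.B1Eq365Concrete` — T. Bałaban, *(Higgs)₂,₃ quantum fields in a finite volume. I. A lower bound*,
Commun. Math. Phys. **85** (1982) 603–626 [Balaban1982Higgs1], p. 624: **`E′` of (3.64) WITH BODY on the concrete
(Higgs)₂,₃ carrier and the composition identity (3.65) `E′ = ½⟨B, Δ^{(k+1),L^{k+1}ε}B⟩ + E_{k+1}` PROVED on the carrier**
— *"Taking into account the law of composition of the renormalization transformations (2.14) and the convention (3.34)"*: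
r14's concrete (2.14) machinery (`B1Eq214Concrete`, `B1RTSemigroup.display214`) combined with the composition of the
block averages CARRYING THE CONVENTION (3.34) (`avgQ_avgQ335`, this file), for the generating functions of the typer's
`B1Eq335GeneratingFunction` (`genFn335C` = (3.35))

statement-level skeleton of published theorems with citation tags; proofs where landed; nothing here is a claim about the Yang–Mills mass gap

PDF held: `paper:balaban1982-cmp85-higgs23-i` (journal page = PDF page + 602); p. 624 read on the ×2 render
`run/shared/lean/pub/pub-balaban/b2b-balaban-ref1/pages/1982-cmp85-higgs23-I/1982-cmp85-higgs23-I-p022-x2.png`, p. 618 on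
`…-p016-x2.png`, p. 609 on `…-p007-x2.png`, never from the OCR layer.

CITATION HEADER (lean-in-tree rule).  lit-balaban typed skeleton (HOME `run/shared/lean/pub/lit-balaban/`), typer line;
located member of the SKELETON rows **B1.Eq3.64**, **B1.Eq3.65** (and, through r12's `step363R_of_eq365_Ici`, of
**B1.Eq3.62-3.63**) — rows of record r12 `lit-balaban-r12/ROWS-B1-part2.md`; decls of record p14's schematic
`B1Eq365Proof.genFn364` / `eq365_rt` (ANY measure `νA`, kernels with ANY block-average map `m`) and r12's
`B1Sect3Statements.Eq365` / `Step363R`; B1 fold owner r14 (PRE-AUDIT `READING-RULE-PREAUDIT-B1-part2-g23.md` §3 class E: the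
carrier instance owed).  Nothing of r12's, r14's, r15's or p14's is edited or re-declared; everything is consumed BY NAME.

THE SOURCE TEXT, p. 624 [PDF 22], verbatim: *"where E′ is an expression given by the formula (3.61) only instead of the
Taylor expansion of the function E_k in the exponent we have the function E_k(e′, λ′, eB^{(k+1)ε} + e′A′^{(k)ε}, φ) itself.
Using the formula (3.35) for it we get
E′(e′, λ′, B, ψ) = ½⟨B, Δ^{(k+1),L^{k+1}ε}B⟩ − log[Π_{j=0}^{k} (a(L^{j+1}ε)^{d−2}/2π)^{(d/2)|T₁^{(j+1)}|} ∫dA′_j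
exp(−½⟨A′_j, (C^{(j),L^jε})⁻¹A′_j⟩) · T^{L^kε}_{a,L,eB^{(k+1)ε}+e′A′^{(k)ε}}[T^ε_{a_k,L^k,eB^{(k+1)ε}+e′Σ_{j=0}^{k}A′^{(j)ε}}
[exp[−½⟨φ′, (−Δ^ε_{eB^{(k+1)ε}+e′Σ_{j=0}^{k}A′^{(j)ε}})φ′⟩ − Σ_{x∈T_ε} ε^d𝒫(e′, λ′, φ′(x)) − E]]]]. (3.64)
Taking into account the law of composition of the renormalization transformations (2.14) and the convention (3.34) we
obtain the following equality E′(e′, λ′, B, ψ) = ½⟨B, Δ^{(k+1),L^{k+1}ε}B⟩ + E_{k+1}(e′, λ′, eB^{(k+1)ε}, ψ). (3.65)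
If we substitute in the formula (3.63) the above expression for E′ and if we change B, ψ into A, φ, then we get precisely
the formula (3.35) for S^{(k+1),L^{k+1}ε}. Thus we have finished the inductive proof of the formula (3.63) for the k^{th}
action."*; p. 609 [PDF 7]: *"T^{L^kε}_{a,L,A}T^ε_{a_k,L^k,A} = T^ε_{a_{k+1},L^{k+1},A}. (2.14)"*; p. 618 [PDF 16] (3.34):
*"A(Γ^{(k)}_{y,x}) = A^{(k),ε}(Γ^{(k)}_{y,x}) + Σ_j A′^{(j),ε}(Γ^{(j+1)}_{x_{j+1},x})"*.

HOW IT IS TYPED (reuse; `P` = the ε-lattice family, `P.mesh j = L^jε`; `D : B1Eq335GeneratingFunction.Data335 P N k` the data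
of the LEVEL-`k` transformation, `D.liftSucc` the same constants at level `k+1`).
* The two transformations of (3.64): the OUTER one-step `T^{L^kε}_{a,L,eB^{(k+1)ε}+e′A′^{(k)ε}}` = typer's/r14's
  `HiggsAveraging.renormTransf C a 𝒜_top` ((2.4)–(2.7); its straight contours `Γ_{z,y}` from level `k` to `k+1` carry the
  field `𝒜_top := eB^{(k+1)ε} + e′A′^{(k)ε}` — print's own subscript; `stepField`); the INNER `k`-th order
  `T^ε_{a_k,L^k,eB^{(k+1)ε}+e′Σ_{j≤k}A′^{(j)ε}}` = `Data335.rt335` of `B1Eq335GeneratingFunction` with top field `𝒜_top` (the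
  pieces of index `≥ k` sit on the whole contour `Γ^{(k)}_{y,x}`) and the lower pieces `e′A′^{(j)ε}`, `j < k`, through the
  convention (3.34) (`avgQ335`, r15's `holK13`).  The density is `Data335.density335` at level `k+1` with
  `𝒜 = eB^{(k+1)ε} + e′Σ_{j=0}^{k}A′^{(j)ε}`; `B^{(k+1)ε}` = (3.29) = r15's `B3MultiscaleFields.topPiece`, `A′^{(k)ε}` =
  `fluctPiece`.
* **`genFn364C` = (3.64)**: `½⟨B, Δ^{(k+1),L^{k+1}ε}B⟩` (typer `HiggsFluctMeasure.deltaK`) `− log[(Π_{j≤k} rtConst_j)·∫Π_j dA′_j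
  (Π_j e^{−½⟨A′_j,(C^{(j)})⁻¹A′_j⟩})·T_outer[T_inner[density]](ψ)]` (the printed nest of Gaussian integrals read as ONE product
  Lebesgue integral, as in `bracket335`).
WHAT IS PROVED (0 sorry).
* §1 `contour13_eq_contour334_add` — the located reading note made a kernel statement: r12's schematic (3.34)
  `B1Sect3Statements.contour334` (printed lower limit `j = 1`) and r15's (1.3) `contour13` (lower limit `j = 0`, the typing)
  differ exactly by the `j = 0` term `A′^{(0),ε}(Γ^{(1)}_{x₁,x})`; **`avgQ_avgQ335`** — the convention (3.34) composes: `Q(𝒜_top) ∘ Q_k(𝒜)|_{(3.34), level k} = Q_{k+1}(𝒜)|_{(3.34), level k+1}`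
  (the transports multiply along `Γ^{(k+1)}_{z,x} = Γ_{z,x_k} ∪ Γ^{(k)}_{x_k,x}`, (2.2): `U_contourSum_holK13`; blocks
  `B^{k+1}(z) = ⋃_{y∈B(z)}B^k(y)`; weights `L^{−d}L^{−kd} = L^{−(k+1)d}`) — the (3.34)-analogue of r14's
  `HiggsAveragingCompose.avgQ_avgQk`.
* §2 block-coordinate transport of the (3.34)-kernel (`m335`, `fieldEquiv_m335`, `kernel335_fieldEquiv`; r14's
  `B1Eq214Concrete.siteEquiv/fieldEquiv/uQ` by name) and **`renormTransf_rt335`**: (2.14) WITH THE CONVENTION (3.34) on the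
  carrier — `T^{L^kε}_{a,L,𝒜_top}[T^ε_{a_k,L^k,𝒜}[ρ]] = T^ε_{a_{k+1},L^{k+1},𝒜}[ρ]` for every integrable density `ρ` of the
  ε-lattice scalar field (`1 ≤ k < K`, `a > 0`, `L > 1`; r14's `B1RTSemigroup.display214` + `compPrec_model`).
* §3 `genFn364C`, **`genFn364C_eq_genFn364`** ((3.64) with body IS p14's schematic `B1Eq365Proof.genFn364` at the printed
  weighted measure `nu335`, the one-step kernel `rtKernelStep`, the (3.34)-kernel `kernel335` and `density335`) and **`eq365_at`**: (3.65) AT `(e′, λ′)` whenever the printed density is integrable there;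
  **`eq365_concrete`** (r12's `Eq365` for `E′ = genFn364C`, `E_{k+1} = liftSucc.genFn335C … (eB^{(k+1)ε})`, under p14's
  standing integrability hypothesis); **`step363R_concrete`** (r12's one-sided `Step363R` from integrability on `λ′ ≥ 0`
  only, `B1Sect3Statements.step363R_of_eq365_Ici`); `integrable_density335` — the hypothesis DISCHARGED for `λ′ > 0`, and
  for `λ′ ≥ 0` with `δm²(e′,λ′) > 0` (typer `B3Eq14Finite.density14_le_of_quartic/of_mass`), hence
  **`eq365_at_of_pos`** ((3.65) unconditionally at every `λ′ > 0`) and **`step363R_concrete_of_pos`** (e.g. whenever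
  `δm²(e′,λ′) > 0` on `λ′ ≥ 0`).
HONEST SCOPE.  Identities of real integrals exactly as printed (`−log` of a real number, p. 624's own caveat *"the formula
is not well defined …"* untouched); at `λ′ < 0` the printed density is not integrable and nothing is claimed there beyond
what the hypotheses say.  Unit `lit-balaban-typer` gen 31 (literature-prover-lit-balaban-typer-g31-0); HOME/FILED.md
records the proposal.
-/

open scoped BigOperators ENNReal
open _root_.MeasureTheory

namespace Literature.MathematicalPhysics.QuantumFieldTheory.Balaban1983to89.B1Eq365Concrete

open Literature.MathematicalPhysics.QuantumFieldTheory.Balaban1983to89.HiggsLattice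
open Literature.MathematicalPhysics.QuantumFieldTheory.Balaban1983to89.HiggsAveraging
open Literature.MathematicalPhysics.QuantumFieldTheory.Balaban1983to89.HiggsCovariance
open Literature.MathematicalPhysics.QuantumFieldTheory.Balaban1983to89.B3MultiscaleFields
open Literature.MathematicalPhysics.QuantumFieldTheory.Balaban1983to89.HiggsFluctMeasure
open Literature.MathematicalPhysics.QuantumFieldTheory.Balaban1983to89.B1RT
open Literature.MathematicalPhysics.QuantumFieldTheory.Balaban1983to89.B1RTSemigroup
open Literature.MathematicalPhysics.QuantumFieldTheory.Balaban1983to89.B3Eq14AuxFunction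
open Literature.MathematicalPhysics.QuantumFieldTheory.Balaban1983to89.B1Eq214Concrete
open Literature.MathematicalPhysics.QuantumFieldTheory.Balaban1983to89.B1Eq335GeneratingFunction

variable {P : HiggsLattice.Params} {N : ℕ}

/-! ## 0. Level bookkeeping: the same constants one level up; the field of the one-step contours -/

section Levels

variable {k : ℕ} (D : Data335 P N k)

/-- The data of (3.35) at level `k + 1` with the same constants (`E_{k+1}` and `E′` of (3.64)/(3.65) are built from the
same `C, μ₀², a, δm², E` as `E_k`). [cite: Balaban1982Higgs1, (3.65) p.624] -/
def liftSucc : Data335 P N (k + 1) := ⟨D.C, D.mu0sq, D.a, D.dm2, D.E⟩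

/-- The level-`k` part of a family `(A′_j)_{j≤k}` of `k + 1` fluctuation fields. [cite: Balaban1982Higgs1, (3.64) p.624] -/
def lower (A' : (j : Fin (k + 1)) → HiggsLattice.VecField P j) : (j : Fin k) → HiggsLattice.VecField P j :=
  fun j => A' (Fin.castSucc j)

/-- **The field of the one-step contours of (3.64)**: `𝒜_top = eB^{(k+1)ε} + e′A′^{(k)ε}` — print's subscript of the OUTER
transformation `T^{L^kε}_{a,L,eB^{(k+1)ε}+e′A′^{(k)ε}}`, and the "top field" (pieces of index `≥ k`, summed on the whole
`Γ^{(k)}_{y,x}` under (3.34)) of the INNER one; here `Top` ↤ `eB^{(k+1)ε}`, `A′^{(k)ε}` = `fluctPiece … k (A′_k)` (3.29)/(3.33).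
[cite: Balaban1982Higgs1, (3.64) p.624] -/
noncomputable def stepField (Top : HiggsLattice.VecField P 0) (e' : ℝ) (A' : (j : Fin (k + 1)) → HiggsLattice.VecField P j) :
    HiggsLattice.VecField P 0 :=
  Top + e' • fluctPiece D.mu0sq D.a k (A' (Fin.last k))

/-- The lower pieces of the two levels agree: for `j < k`, `e′A′^{(j)ε}` is the same field whether the family is indexed
by `Fin k` or `Fin (k+1)`. [cite: Balaban1982Higgs1, (3.34) p.618] -/
theorem extPieces_lower {e' : ℝ} (A' : (j : Fin (k + 1)) → HiggsLattice.VecField P j) {j : ℕ} (hj : j < k) :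
    D.extPieces e' (lower A') j = (liftSucc D).extPieces e' A' j := by
  have hj' : j < k + 1 := hj.trans (Nat.lt_succ_self k)
  simp only [Data335.extPieces, hj, hj', dif_pos, lower, liftSucc, Fin.castSucc_mk]

/-- The new piece at level `k + 1` is `e′A′^{(k)ε}`. [cite: Balaban1982Higgs1, (3.34) p.618] -/
theorem extPieces_liftSucc_top (e' : ℝ) (A' : (j : Fin (k + 1)) → HiggsLattice.VecField P j) :
    (liftSucc D).extPieces e' A' k = e' • fluctPiece D.mu0sq D.a k (A' (Fin.last k)) := by
  simp only [Data335.extPieces, Nat.lt_succ_self, dif_pos, liftSucc]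
  rfl

end Levels

/-! ## 1. The convention (3.34) composes: `Q(𝒜_top) Q_k(𝒜) = Q_{k+1}(𝒜)` -/

section Compose

variable {k : ℕ} (D : Data335 P N k)

/-- **(3.34) as printed versus III (1.3) as typed** (r12's schematic `B1Sect3Statements.contour334 top lower k = top +
Σ_{j=1}^{k−1} lower_j`, verbatim lower limit `j = 1`; r15's `B3MultiscaleFields.contour13`, lower limit `j = 0`): on the carrier,
for `k + 1` steps, `A(Γ^{(k+1)}_{y,x})|_{(1.3)} = contour334 (A^{(k+1),ε}(Γ^{(k+1)}_{y,x})) (j ↦ A′^{(j),ε}(Γ^{(j+1)}_{x_{j+1},x})) (k+1)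
+ A′^{(0),ε}(Γ^{(1)}_{x₁,x})` — the two conventions differ exactly by the `j = 0` term (the located reading note of
`B1Eq335GeneratingFunction`; no repair asserted, the typing follows (1.3)). [cite: Balaban1982Higgs1, (3.34) p.618] -/
theorem contour13_eq_contour334_add (n : ℕ) (F : ℕ → HiggsLattice.VecField P 0) (Ftop : HiggsLattice.VecField P 0)
    (x : HiggsLattice.Site P 0) :
    contour13 (n + 1) F Ftop x
      = B1Sect3Statements.contour334 (etaSumK Ftop (n + 1) x) (fun j => etaSumK (F j) (j + 1) x) (n + 1)
          + etaSumK (F 0) 1 x := by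
  rw [contour13, B1Sect3Statements.contour334, Nat.add_sub_cancel, Finset.range_eq_Ico,
    Finset.sum_eq_sum_Ico_succ_bot (Nat.succ_pos n), zero_add]
  rw [show Finset.Ico 1 (Nat.succ n) = Finset.Icc 1 n from Finset.Ico_add_one_right_eq_Icc 1 n]
  ring

/-- `U` at spacing `η` is `U` at spacing `1` of `η·A` (`U(A) = exp(qηeA)`, p. 605). [cite: Balaban1982Higgs1, (1.7) p.605] -/
theorem U_eq_U_one (C : ChargeData N) (η A : ℝ) : C.U η A = C.U 1 (η * A) := by
  unfold ChargeData.U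
  congr 2
  ring

/-- **The transports multiply along the concatenation (2.2) UNDER THE CONVENTION (3.34)**: for `x ∈ B^{k+1}(z)`,
`U(𝒜_top(Γ_{z,x_k})) · U(𝒜(Γ^{(k)}_{x_k,x}))|_{(3.34), top 𝒜_top} = U(𝒜(Γ^{(k+1)}_{z,x}))|_{(3.34), top eB^{(k+1)ε}}` — the pieces
`e′A′^{(j)ε}`, `j < k`, stay on `Γ^{(j+1)}_{x_{j+1},x}`, the piece `e′A′^{(k)ε}` and `eB^{(k+1)ε}` pick up the segment
`Γ_{z,x_k}` (r15's `etaSumK_succ`, `contour13_succ`; `ChargeData.U_add`). [cite: Balaban1982Higgs1, (3.34) p.618] -/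
theorem U_contourSum_holK13 (Top : HiggsLattice.VecField P 0) (e' : ℝ) (A' : (j : Fin (k + 1)) → HiggsLattice.VecField P j)
    (z : HiggsLattice.Site P (k + 1)) (x : HiggsLattice.Site P 0) (hx : x ∈ blockK (k + 1) z)
    (v : EuclideanSpace ℝ (Fin N)) :
    D.C.U (P.mesh 0) (contourSum (stepField D Top e' A') (toFinest z) (toFinest (blockIter k x)))
        (holK13 D.C k (D.extPieces e' (lower A')) (stepField D Top e' A') x v)
      = holK13 D.C (k + 1) ((liftSucc D).extPieces e' A') Top x v := by
  have hz : blockIter (k + 1) x = z := (mem_blockK (k + 1) z x).mp hx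
  have key : P.mesh 0 * contourSum (stepField D Top e' A') (toFinest z) (toFinest (blockIter k x))
      + contour13 k (D.extPieces e' (lower A')) (stepField D Top e' A') x
      = contour13 (k + 1) ((liftSucc D).extPieces e' A') Top x := by
    rw [contour13_succ, contour13, extPieces_liftSucc_top,
      Finset.sum_congr rfl fun j hj => by rw [extPieces_lower D A' (Finset.mem_range.mp hj)],
      add_assoc (∑ j ∈ Finset.range k, _) _ _, ← etaSumK_add, etaSumK_succ, hz]
    have hT : e' • fluctPiece D.mu0sq D.a k (A' (Fin.last k)) + Top = stepField D Top e' A' := by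
      rw [stepField, add_comm]
    rw [hT, etaSum]
    ring
  have hmul : ∀ (f g : EuclideanSpace ℝ (Fin N) →L[ℝ] EuclideanSpace ℝ (Fin N)) (w : EuclideanSpace ℝ (Fin N)),
      f (g w) = (f * g) w := fun _ _ _ => rfl
  rw [holK13, holK13, U_eq_U_one D.C (P.mesh 0), hmul, ← ChargeData.U_add, key]

/-- **`Q(𝒜_top) Q_k(𝒜) = Q_{k+1}(𝒜)` WITH THE CONVENTION (3.34)** (the operator content of *"the law of composition … (2.14)
and the convention (3.34)"*, p. 624): averaging the (3.34)-averages of level `k` (top field `𝒜_top = eB^{(k+1)ε} + e′A′^{(k)ε}`)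
over the next blocks with the transports of `𝒜_top` IS the (3.34)-average of level `k + 1` (top field `eB^{(k+1)ε}`, `k + 1`
pieces). [cite: Balaban1982Higgs1, (3.65) p.624] -/
theorem avgQ_avgQ335 (Top : HiggsLattice.VecField P 0) (e' : ℝ) (A' : (j : Fin (k + 1)) → HiggsLattice.VecField P j)
    (φ' : HiggsLattice.ScalarField P 0 N) :
    avgQ D.C (stepField D Top e' A') (D.avgQ335 (stepField D Top e' A') e' (lower A') φ')
      = (liftSucc D).avgQ335 Top e' A' φ' := by
  funext z
  rw [avgQ_apply]
  unfold Data335.avgQ335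
  simp_rw [map_smul, map_sum]
  have hfib : ∀ F : HiggsLattice.Site P 0 → EuclideanSpace ℝ (Fin N),
      ∑ y ∈ HiggsLattice.block z, ∑ x ∈ blockK k y, F x = ∑ x ∈ blockK (k + 1) z, F x := by
    intro F
    have hmaps : ∀ x ∈ blockK (k + 1) z, blockIter k x ∈ HiggsLattice.block z :=
      fun x hx => (HiggsAveragingCompose.mem_blockK_succ k z x).mp hx
    rw [← Finset.sum_fiberwise_of_maps_to hmaps]
    refine Finset.sum_congr rfl fun y hy => ?_
    refine Finset.sum_congr ?_ fun _ _ => rfl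
    ext x
    simp only [Finset.mem_filter, mem_blockK]
    constructor
    · intro h
      refine ⟨?_, h⟩
      rw [HiggsAveragingCompose.blockIter_succ, h]
      simpa [HiggsLattice.block] using hy
    · exact fun h => h.2
  have hpt : ∀ y ∈ HiggsLattice.block z, ∀ x ∈ blockK k y,
      D.C.U (P.mesh 0) (contourSum (stepField D Top e' A') (toFinest z) (toFinest y))
          (holK13 D.C k (D.extPieces e' (lower A')) (stepField D Top e' A') x (φ' x))
        = holK13 D.C (k + 1) ((liftSucc D).extPieces e' A') Top x (φ' x) := by
    intro y hy x hx
    have hyx : blockIter k x = y := (mem_blockK k y x).mp hx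
    have hxz : x ∈ blockK (k + 1) z := by
      rw [HiggsAveragingCompose.mem_blockK_succ, hyx]; exact hy
    have hU := U_contourSum_holK13 D Top e' A' z x hxz (φ' x)
    rw [hyx] at hU
    exact hU
  rw [Finset.sum_congr rfl fun y hy => by rw [Finset.smul_sum, Finset.sum_congr rfl fun x hx => by rw [hpt y hy x hx]]]
  simp_rw [← Finset.smul_sum]
  rw [hfib, smul_smul]
  have hC : (liftSucc D).C = D.C := rfl
  rw [hC]
  congr 1
  rw [← mul_inv, ← pow_add]
  congr 2
  ring

end Compose

/-! ## 2. (2.14) with the convention (3.34) on the carrier -/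

section Semigroup

variable {k : ℕ} (D : Data335 P N k)

/-- The (3.34)-average of level `k` in block coordinates: `m φ′ (z, r) = (Q_k(𝒜)φ′)(blockSite z r)` (r14's `mQk` with the
convention). [cite: Balaban1982Higgs1, (2.11) p.609] -/
noncomputable def m335 (Top : HiggsLattice.VecField P 0) (e' : ℝ) (A' : (j : Fin (k + 1)) → HiggsLattice.VecField P j)
    (φ' : HiggsLattice.ScalarField P 0 N) (p : HiggsLattice.Site P (k + 1) × (Fin P.d → Fin P.L)) :
    EuclideanSpace ℝ (Fin N) :=
  D.avgQ335 (stepField D Top e' A') e' (lower A') φ' (blockSite p.1 p.2)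

/-- `fieldEquiv (m335 φ′) = Q_k(𝒜)φ′` (block coordinates ↦ sites of `T^{(k)}`). [cite: Balaban1982Higgs1, (2.11) p.609] -/
theorem fieldEquiv_m335 (hk : k < P.K) (Top : HiggsLattice.VecField P 0) (e' : ℝ)
    (A' : (j : Fin (k + 1)) → HiggsLattice.VecField P j) (φ' : HiggsLattice.ScalarField P 0 N) :
    fieldEquiv (N := N) hk (m335 D Top e' A' φ') = D.avgQ335 (stepField D Top e' A') e' (lower A') φ' := by
  funext x
  rw [fieldEquiv_apply, m335, siteEquiv_apply]
  show D.avgQ335 _ e' (lower A') φ' (blockSite (HiggsLattice.blockOf x) (posInBlock x)) = _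
  rw [blockSite_blockOf_posInBlock hk]

/-- `m335` is continuous in the fine field (the average is linear in `φ′`; typer `B3Eq14Finite.continuous_avgQ14` through
`avgQ335_eq_avgQ14`). [cite: Balaban1982Higgs1, (2.11) p.609] -/
theorem continuous_m335 (Top : HiggsLattice.VecField P 0) (e' : ℝ) (A' : (j : Fin (k + 1)) → HiggsLattice.VecField P j) :
    Continuous (m335 D Top e' A') := by
  refine continuous_pi fun p => ?_
  have h : Continuous fun φ' : HiggsLattice.ScalarField P 0 N =>
      (D.toData14 0).avgQ14 (stepField D Top e' A') e' (lower A') φ' :=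
    B3Eq14Finite.continuous_avgQ14 (D.toData14 0) (stepField D Top e' A') e' continuous_const continuous_id
  have h' : Continuous fun φ' : HiggsLattice.ScalarField P 0 N => D.avgQ335 (stepField D Top e' A') e' (lower A') φ' := by
    refine h.congr fun φ' => ?_
    exact (D.avgQ335_eq_avgQ14 0 (stepField D Top e' A') e' (lower A') φ').symm
  exact (continuous_apply (blockSite p.1 p.2)).comp h'

/-- The (3.34)-kernel of level `k` on a transported middle field IS the product-model kernel `B1RT.blockKernel β m335`.
[cite: Balaban1982Higgs1, (2.10) p.609] -/
theorem kernel335_fieldEquiv (hk : k < P.K) (Top : HiggsLattice.VecField P 0) (e' : ℝ)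
    (A' : (j : Fin (k + 1)) → HiggsLattice.VecField P j) (g : HiggsLattice.Site P (k + 1) × (Fin P.d → Fin P.L) → EuclideanSpace ℝ (Fin N))
    (φ' : HiggsLattice.ScalarField P 0 N) :
    D.kernel335 (stepField D Top e' A') e' (lower A') (fieldEquiv hk g) φ'
      = blockKernel (prec (B1.aSeq D.a P.L k) (P.mesh k) P.d) (m335 D Top e' A') g φ' := by
  rw [Data335.kernel335_eq, blockKernel_eq]
  refine Fintype.prod_equiv (siteEquiv hk) _ _ fun x => ?_
  rw [fieldEquiv_apply, m335]
  show rtKernel _ (g (siteEquiv hk x) - D.avgQ335 _ e' (lower A') φ' x)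
      = rtKernel _ (g (siteEquiv hk x) - D.avgQ335 _ e' (lower A') φ' (blockSite (HiggsLattice.blockOf x) (posInBlock x)))
  rw [blockSite_blockOf_posInBlock hk]

/-- **(2.14) WITH THE CONVENTION (3.34) on the carrier**: for `1 ≤ k < K`, `a > 0`, `L > 1` and every integrable density
`ρ` of the ε-lattice scalar field, `T^{L^kε}_{a,L,𝒜_top}[T^ε_{a_k,L^k,𝒜}[ρ]] = T^ε_{a_{k+1},L^{k+1},𝒜}[ρ]` — outer one-step
transformation `HiggsAveraging.renormTransf` at the field `𝒜_top = eB^{(k+1)ε} + e′A′^{(k)ε}` of the one-step contours, inner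
and composed transformations `Data335.rt335` with the (3.34)-averages of levels `k` and `k + 1` (r14's `display214`, the
block parametrisation `B1Eq214Concrete.siteEquiv/fieldEquiv/uQ`, `compPrec_model`, and `avgQ_avgQ335`).
[cite: Balaban1982Higgs1, (2.14) p.609] -/
theorem renormTransf_rt335 (hk1 : 1 ≤ k) (hkK : k < P.K) (ha : 0 < D.a) (hL : 1 < P.L) (Top : HiggsLattice.VecField P 0)
    (e' : ℝ) (A' : (j : Fin (k + 1)) → HiggsLattice.VecField P j) {ρ : HiggsLattice.ScalarField P 0 N → ℝ} (hρ : Integrable ρ) :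
    renormTransf D.C D.a (stepField D Top e' A') (D.rt335 (stepField D Top e' A') e' (lower A') ρ)
      = (liftSucc D).rt335 Top e' A' ρ := by
  have hL' : (1 : ℝ) < P.L := by exact_mod_cast hL
  set T := stepField D Top e' A' with hT
  set α := prec D.a (P.mesh (k + 1)) P.d with hα
  set β := prec (B1.aSeq D.a P.L k) (P.mesh k) P.d with hβ
  set w : ℝ := ((P.L : ℝ) ^ P.d)⁻¹ with hw
  have hαpos : 0 < α := prec_pos ha (P.mesh_pos (k + 1)) P.d
  have hβpos : 0 < β := prec_pos (B1.aSeq_pos ha hL' hk1) (P.mesh_pos k) P.d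
  have h214 := display214 (V := EuclideanSpace ℝ (Fin N)) hαpos hβpos w (uQ D.C T (k := k))
    (continuous_m335 D Top e' A').measurable hρ
  rw [display214_iff] at h214
  funext ψ
  have hmp := measurePreserving_fieldEquiv (N := N) (P := P) hkK
  have hL1 : renormTransf D.C D.a T (D.rt335 T e' (lower A') ρ) ψ
      = ∫ g, blockKernel α (qAvg w (uQ D.C T)) ψ g *
          ∫ φ, blockKernel β (m335 D Top e' A') g φ * ρ φ := by
    rw [renormTransf, rtOp_eq, ← hmp.integral_comp']
    refine integral_congr_ae (Filter.Eventually.of_forall fun g => ?_)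
    simp only [Data335.rt335, rtOp_eq]
    rw [rtKernelStep_fieldEquiv D.C T hkK D.a ψ g]
    congr 1
    refine integral_congr_ae (Filter.Eventually.of_forall fun φ => ?_)
    dsimp only
    rw [hT, kernel335_fieldEquiv D hkK Top e' A' g φ]
  have hR : (liftSucc D).rt335 Top e' A' ρ ψ
      = ∫ φ, blockKernel (compPrec α β w (Fintype.card (Fin P.d → Fin P.L)))
          (fun φ => qAvg w (uQ D.C T) (m335 D Top e' A' φ)) ψ φ * ρ φ := by
    rw [Data335.rt335, rtOp_eq]
    refine integral_congr_ae (Filter.Eventually.of_forall fun φ => ?_)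
    dsimp only
    congr 1
    rw [hα, hβ, hw, compPrec_model ha hL hk1, Data335.kernel335_eq, blockKernel_eq]
    refine Finset.prod_congr rfl fun z _ => ?_
    have ha' : (liftSucc D).a = D.a := rfl
    rw [ha', ← avgQ_fieldEquiv D.C T hkK, fieldEquiv_m335 D hkK, hT, avgQ_avgQ335 D]
  rw [hL1, hR]
  exact h214 ψ

end Semigroup

/-! ## 3. (3.64) WITH BODY and (3.65) on the carrier -/

section Eq365

variable {k : ℕ} (D : Data335 P N k)

/-- **(3.64)** p. 624 [PDF 22] — `E′(e′, λ′, B, ψ)` WITH BODY: `½⟨B, Δ^{(k+1),L^{k+1}ε}B⟩ − log[(Π_{j=0}^{k} rtConst_j) ·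
∫Π_j dA′_j (Π_j e^{−½⟨A′_j,(C^{(j),L^jε})⁻¹A′_j⟩}) · T^{L^kε}_{a,L,eB^{(k+1)ε}+e′A′^{(k)ε}}[T^ε_{a_k,L^k,eB^{(k+1)ε}+e′Σ_{j≤k}A′^{(j)ε}}
[density]](ψ)]` — `Δ^{(k+1),L^{k+1}ε}` = typer `HiggsFluctMeasure.deltaK` on the site function of `B`, `B^{(k+1)ε}` = (3.29) =
r15 `topPiece`, the weights/prefactors/density those of `B1Eq335GeneratingFunction` at level `k + 1`, the outer transformation
`HiggsAveraging.renormTransf`, the inner `Data335.rt335` (level `k`, convention (3.34)); `e` the coupling, `(e′, λ′)` the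
generating variables. [cite: Balaban1982Higgs1, (3.64) p.624] -/
noncomputable def genFn364C (e' l' e : ℝ) (B : HiggsLattice.VecField P (k + 1)) (ψ : HiggsLattice.ScalarField P (k + 1) N) : ℝ :=
  1 / 2 * siteInner (toSite B) (HiggsFluctMeasure.deltaK P D.mu0sq D.a (k + 1) (toSite B))
    - Real.log ((∏ j : Fin (k + 1), (liftSucc D).rtConst j) *
        ∫ A' : (j : Fin (k + 1)) → HiggsLattice.VecField P j, (liftSucc D).famWeight A' *
          renormTransf D.C D.a (stepField D (e • topPiece D.mu0sq D.a (k + 1) B) e' A')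
            (D.rt335 (stepField D (e • topPiece D.mu0sq D.a (k + 1) B) e' A') e' (lower A')
              ((liftSucc D).density335 (e • topPiece D.mu0sq D.a (k + 1) B) e' l' A')) ψ)

/-- Unfolding of `genFn364C` = (3.64) as printed. [cite: Balaban1982Higgs1, (3.64) p.624] -/
theorem genFn364C_eq (e' l' e : ℝ) (B : HiggsLattice.VecField P (k + 1)) (ψ : HiggsLattice.ScalarField P (k + 1) N) :
    genFn364C D e' l' e B ψ
      = 1 / 2 * siteInner (toSite B) (HiggsFluctMeasure.deltaK P D.mu0sq D.a (k + 1) (toSite B))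
        - Real.log ((∏ j : Fin (k + 1), (liftSucc D).rtConst j) *
            ∫ A' : (j : Fin (k + 1)) → HiggsLattice.VecField P j, (liftSucc D).famWeight A' *
              renormTransf D.C D.a (stepField D (e • topPiece D.mu0sq D.a (k + 1) B) e' A')
                (D.rt335 (stepField D (e • topPiece D.mu0sq D.a (k + 1) B) e' A') e' (lower A')
                  ((liftSucc D).density335 (e • topPiece D.mu0sq D.a (k + 1) B) e' l' A')) ψ) := rfl

/-- **(3.64) WITH BODY IS p14's SCHEMATIC (3.64)** — `B1Eq365Proof.genFn364 quadB νA t₁ t₂ ρ ψ e′ λ′ = ½quadB −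
log ∫ T_{t₁(e′,a)}[T_{t₂(e′,a)}[ρ(e′,λ′,a)]](ψ) dνA(a)` at `quadB := ⟨B, Δ^{(k+1),L^{k+1}ε}B⟩`, `νA := nu335` of level `k + 1` (the
printed weighted measure `(Π_{j≤k} rtConst_j)·Π_j e^{−½⟨A′_j,(C^{(j)})⁻¹A′_j⟩}·Π_j dA′_j`), outer kernel `t₁ e′ A′ :=
HiggsAveraging.rtKernelStep C a (eB^{(k+1)ε} + e′A′^{(k)ε})` ((2.5)–(2.7)), inner kernel `t₂ e′ A′ := kernel335` of level `k` with the
(3.34)-averages, `ρ := density335` of level `k + 1` (`a > 0`). [cite: Balaban1982Higgs1, (3.64) p.624] -/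
theorem genFn364C_eq_genFn364 (ha : 0 < D.a) (e' l' e : ℝ) (B : HiggsLattice.VecField P (k + 1))
    (ψ : HiggsLattice.ScalarField P (k + 1) N) :
    genFn364C D e' l' e B ψ
      = B1Eq365Proof.genFn364 (siteInner (toSite B) (HiggsFluctMeasure.deltaK P D.mu0sq D.a (k + 1) (toSite B)))
          (liftSucc D).nu335
          (fun e₁ A' => rtKernelStep D.C D.a (stepField D (e • topPiece D.mu0sq D.a (k + 1) B) e₁ A'))
          (fun e₁ A' => D.kernel335 (stepField D (e • topPiece D.mu0sq D.a (k + 1) B) e₁ A') e₁ (lower A'))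
          (fun e₁ l₁ A' => (liftSucc D).density335 (e • topPiece D.mu0sq D.a (k + 1) B) e₁ l₁ A') ψ e' l' := by
  rw [B1Eq365Proof.genFn364_eq, (liftSucc D).integral_nu335 ha, genFn364C]
  rfl

/-- **(3.65) p. 624 ON THE CARRIER, at the couplings `(e′, λ′)`**: if the printed density is integrable in the old scalar
field at `(e′, λ′)` (for every fluctuation family), then `E′(e′, λ′, B, ψ) = ½⟨B, Δ^{(k+1),L^{k+1}ε}B⟩ + E_{k+1}(e′, λ′,
eB^{(k+1)ε}, ψ)` with `E′ = genFn364C` and `E_{k+1}` = (3.35) at level `k + 1` (`liftSucc.genFn335C`); `1 ≤ k < K`, `a > 0`,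
`L > 1`.  *"Taking into account the law of composition of the renormalization transformations (2.14) and the convention
(3.34)"* = `renormTransf_rt335` under the Gaussian integrals. [cite: Balaban1982Higgs1, (3.65) p.624] -/
theorem eq365_at (hk1 : 1 ≤ k) (hkK : k < P.K) (ha : 0 < D.a) (hL : 1 < P.L) (e' l' e : ℝ) (B : HiggsLattice.VecField P (k + 1))
    (ψ : HiggsLattice.ScalarField P (k + 1) N)
    (hρ : ∀ A' : (j : Fin (k + 1)) → HiggsLattice.VecField P j,
      Integrable ((liftSucc D).density335 (e • topPiece D.mu0sq D.a (k + 1) B) e' l' A')) :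
    genFn364C D e' l' e B ψ
      = 1 / 2 * siteInner (toSite B) (HiggsFluctMeasure.deltaK P D.mu0sq D.a (k + 1) (toSite B))
        + (liftSucc D).genFn335C e' l' (e • topPiece D.mu0sq D.a (k + 1) B) ψ := by
  have hint : (∫ A' : (j : Fin (k + 1)) → HiggsLattice.VecField P j, (liftSucc D).famWeight A' *
          renormTransf D.C D.a (stepField D (e • topPiece D.mu0sq D.a (k + 1) B) e' A')
            (D.rt335 (stepField D (e • topPiece D.mu0sq D.a (k + 1) B) e' A') e' (lower A')
              ((liftSucc D).density335 (e • topPiece D.mu0sq D.a (k + 1) B) e' l' A')) ψ)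
      = ∫ A' : (j : Fin (k + 1)) → HiggsLattice.VecField P j, (liftSucc D).famWeight A' *
          (liftSucc D).rt335 (e • topPiece D.mu0sq D.a (k + 1) B) e' A'
            ((liftSucc D).density335 (e • topPiece D.mu0sq D.a (k + 1) B) e' l' A') ψ := by
    refine integral_congr_ae (Filter.Eventually.of_forall fun A' => ?_)
    dsimp only
    rw [renormTransf_rt335 D (hk1 := hk1) hkK ha hL (e • topPiece D.mu0sq D.a (k + 1) B) e' A' (hρ A')]
  rw [genFn364C, hint, Data335.genFn335C, Data335.bracket335]
  ring

/-- **r12's (3.65) of record for the concrete `E′`, `E_{k+1}`** — `B1Sect3Statements.Eq365 E′ E_{k+1} ⟨B, Δ^{(k+1)}B⟩`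
under p14's standing hypothesis that the density is integrable at every `(e′, λ′)` (cf. `B1Eq365Proof.eq365_rt`).
[cite: Balaban1982Higgs1, (3.65) p.624] -/
theorem eq365_concrete (hk1 : 1 ≤ k) (hkK : k < P.K) (ha : 0 < D.a) (hL : 1 < P.L) (e : ℝ) (B : HiggsLattice.VecField P (k + 1))
    (ψ : HiggsLattice.ScalarField P (k + 1) N)
    (hρ : ∀ (e' l' : ℝ) (A' : (j : Fin (k + 1)) → HiggsLattice.VecField P j),
      Integrable ((liftSucc D).density335 (e • topPiece D.mu0sq D.a (k + 1) B) e' l' A')) :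
    B1Sect3Statements.Eq365 (fun e' l' => genFn364C D e' l' e B ψ)
      (fun e' l' => (liftSucc D).genFn335C e' l' (e • topPiece D.mu0sq D.a (k + 1) B) ψ)
      (siteInner (toSite B) (HiggsFluctMeasure.deltaK P D.mu0sq D.a (k + 1) (toSite B))) :=
  fun e' l' => eq365_at D (hk1 := hk1) hkK ha hL e' l' e B ψ (hρ e' l')

/-- **(3.65) ⇒ (3.63) ⇔ (3.36)_{k+1} on the carrier, ONE-SIDED READING of record**: r12's `Step363R E′ E_{k+1} ⟨B,ΔB⟩ e λ n̄`
for the concrete generating functions, from integrability of the printed density on the physical half-plane `λ′ ≥ 0` only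
(`B1Sect3Statements.step363R_of_eq365_Ici`). [cite: Balaban1982Higgs1, (3.63)–(3.65) p.624] -/
theorem step363R_concrete (hk1 : 1 ≤ k) (hkK : k < P.K) (ha : 0 < D.a) (hL : 1 < P.L) (e lam : ℝ) (nbar : ℕ)
    (B : HiggsLattice.VecField P (k + 1)) (ψ : HiggsLattice.ScalarField P (k + 1) N)
    (hρ : ∀ (e' l' : ℝ), 0 ≤ l' → ∀ A' : (j : Fin (k + 1)) → HiggsLattice.VecField P j,
      Integrable ((liftSucc D).density335 (e • topPiece D.mu0sq D.a (k + 1) B) e' l' A')) :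
    B1Sect3Statements.Step363R (fun e' l' => genFn364C D e' l' e B ψ)
      (fun e' l' => (liftSucc D).genFn335C e' l' (e • topPiece D.mu0sq D.a (k + 1) B) ψ)
      (siteInner (toSite B) (HiggsFluctMeasure.deltaK P D.mu0sq D.a (k + 1) (toSite B))) e lam nbar :=
  B1Sect3Statements.step363R_of_eq365_Ici
    (fun e' l' hl' => eq365_at D (hk1 := hk1) hkK ha hL e' l' e B ψ (hρ e' l' hl')) e lam nbar

/-- **The closing sentence p. 624 on the carrier, ONE-SIDED READING** — *"If we substitute in the formula (3.63) the above
expression for E′ and if we change B, ψ into A, φ, then we get precisely the formula (3.36) for S^{(k+1),L^{k+1}ε}"*: with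
`S^{(k+1),L^{k+1}ε}(B, ψ)` GIVEN by (3.63) (r12's one-sided Taylor sum `pertSum362R` of the concrete `E′ = genFn364C`), r12's
`Eq336R` of record holds at level `k + 1` with `E_{k+1}` = (3.35) at level `k + 1` and the quadratic term `⟨B, Δ^{(k+1),L^{k+1}ε}B⟩`
(integrability of the printed density on `λ′ ≥ 0`; `1 ≤ k < K`, `a > 0`, `L > 1`). [cite: Balaban1982Higgs1, (3.63)–(3.65) p.624; (3.36) p.618] -/
theorem eq336R_succ_concrete (hk1 : 1 ≤ k) (hkK : k < P.K) (ha : 0 < D.a) (hL : 1 < P.L) (e lam : ℝ) (nbar : ℕ)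
    (B : HiggsLattice.VecField P (k + 1)) (ψ : HiggsLattice.ScalarField P (k + 1) N)
    (hρ : ∀ (e' l' : ℝ), 0 ≤ l' → ∀ A' : (j : Fin (k + 1)) → HiggsLattice.VecField P j,
      Integrable ((liftSucc D).density335 (e • topPiece D.mu0sq D.a (k + 1) B) e' l' A')) :
    B1Sect3Statements.Eq336R
      (B1Sect3Statements.pertSum362R (fun e' l' => genFn364C D e' l' e B ψ) e lam nbar)
      (siteInner (toSite B) (HiggsFluctMeasure.deltaK P D.mu0sq D.a (k + 1) (toSite B)))
      (fun e' l' => (liftSucc D).genFn335C e' l' (e • topPiece D.mu0sq D.a (k + 1) B) ψ) e lam nbar := by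
  unfold B1Sect3Statements.Eq336R
  exact step363R_concrete D (hk1 := hk1) hkK ha hL e lam nbar B ψ hρ

end Eq365

/-! ## 4. The integrability hypothesis discharged where the printed density is integrable -/

section Integrable

variable {k : ℕ} (D : Data335 P N k)

/-- The Gaussian `exp(−c|v|²)`, `c > 0`, is integrable on `ℝ^N`. [folklore] -/
private theorem integrable_exp_neg_mul_sq_norm {c : ℝ} (hc : 0 < c) :
    Integrable fun v : EuclideanSpace ℝ (Fin N) => Real.exp (-c * ‖v‖ ^ 2) := by
  refine Integrable.of_integral_ne_zero ?_
  rw [GaussianFourier.integral_rexp_neg_mul_sq_norm hc]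
  exact (Real.rpow_pos_of_pos (div_pos Real.pi_pos hc) _).ne'

/-- **The printed density of (3.35)/(3.64) is integrable in the old scalar field** at the couplings `(e′, λ′)` with `λ′ > 0`,
or with `λ′ ≥ 0` and `δm²(e′, λ′) > 0` (Gaussian majorant of the typer's `B3Eq14Finite.density14_le_of_quartic` /
`density14_le_of_mass` through the dictionary `toData14 1`, i.e. scalar mass `1` and counterterm `δm² − 1`).
[cite: Balaban1982Higgs1, (3.35) p.618] -/
theorem integrable_density335 {e' l' : ℝ} (hl : 0 ≤ l') (hreg : 0 < l' ∨ 0 < D.dm2 e' l') (Ak : HiggsLattice.VecField P 0)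
    (A' : (j : Fin k) → HiggsLattice.VecField P j) : Integrable (D.density335 Ak e' l' A') := by
  have hq : 0 ≤ l' * (D.toData14 1).lamRun := by show 0 ≤ l' * 1; rw [mul_one]; exact hl
  obtain ⟨K, c, hc, hK⟩ : ∃ K c : ℝ, 0 < c ∧ ∀ (Ak : HiggsLattice.VecField P 0)
      (A' : (j : Fin k) → HiggsLattice.VecField P j) (φ' : HiggsLattice.ScalarField P 0 N),
      (D.toData14 1).density14 Ak e' l' A' φ' ≤ Real.exp (K - c * B3Eq15OneSidedInteraction.sqSum φ') := by
    rcases hreg with h | h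
    · exact B3Eq14Finite.density14_le_of_quartic (D.toData14 1) one_pos one_ne_zero (by show 0 < l' * 1; rw [mul_one]; exact h)
    · refine B3Eq14Finite.density14_le_of_mass (D.toData14 1) one_pos one_ne_zero hq fun x _ => ?_
      show 0 < 1 + (D.dm2 e' l' - 1)
      linarith
  have hgauss : Integrable fun φ' : HiggsLattice.ScalarField P 0 N => ∏ x, Real.exp (-c * ‖φ' x‖ ^ 2) :=
    Integrable.fintype_prod (f := fun (_ : HiggsLattice.Site P 0) (v : EuclideanSpace ℝ (Fin N)) => Real.exp (-c * ‖v‖ ^ 2))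
      fun _ => integrable_exp_neg_mul_sq_norm hc
  have hcont : Continuous (D.density335 Ak e' l' A') := by
    have h := B3Eq14Finite.continuous_density14 (D.toData14 1) Ak e' l' (A' := fun _ : HiggsLattice.ScalarField P 0 N => A')
      (φ' := id) continuous_const continuous_id
    exact h.congr fun φ' => (D.density335_eq_density14 1 Ak e' l' A' φ').symm
  refine ((hgauss.const_mul (Real.exp K)).mono' hcont.aestronglyMeasurable (Filter.Eventually.of_forall fun φ' => ?_))
  rw [Real.norm_eq_abs, abs_of_pos (D.density335_pos Ak e' l' A' φ'), D.density335_eq_density14 1]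
  have h3 : Real.exp (K - c * B3Eq15OneSidedInteraction.sqSum φ') = Real.exp K * ∏ x, Real.exp (-c * ‖φ' x‖ ^ 2) := by
    rw [B3Eq15OneSidedInteraction.sqSum, ← Real.exp_sum, ← Real.exp_add, Finset.mul_sum, sub_eq_add_neg,
      ← Finset.sum_neg_distrib]
    refine congrArg Real.exp (congrArg _ (Finset.sum_congr rfl fun x _ => ?_))
    ring
  rw [← h3]
  exact hK Ak A' φ'

/-- **(3.65) p. 624 ON THE CARRIER, UNCONDITIONALLY ON THE OPEN HALF-PLANE `λ′ > 0`** (and at `λ′ = 0` when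
`δm²(e′, 0) > 0`): `E′(e′, λ′, B, ψ) = ½⟨B, Δ^{(k+1),L^{k+1}ε}B⟩ + E_{k+1}(e′, λ′, eB^{(k+1)ε}, ψ)` for `E′ = genFn364C`,
`E_{k+1}` = (3.35) at level `k + 1`; `1 ≤ k < K`, `a > 0`, `L > 1` — `eq365_at` with its integrability hypothesis
discharged by `integrable_density335`. [cite: Balaban1982Higgs1, (3.65) p.624] -/
theorem eq365_at_of_pos (hk1 : 1 ≤ k) (hkK : k < P.K) (ha : 0 < D.a) (hL : 1 < P.L) {e' l' : ℝ} (hl : 0 ≤ l')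
    (hreg : 0 < l' ∨ 0 < D.dm2 e' l') (e : ℝ) (B : HiggsLattice.VecField P (k + 1))
    (ψ : HiggsLattice.ScalarField P (k + 1) N) :
    genFn364C D e' l' e B ψ
      = 1 / 2 * siteInner (toSite B) (HiggsFluctMeasure.deltaK P D.mu0sq D.a (k + 1) (toSite B))
        + (liftSucc D).genFn335C e' l' (e • topPiece D.mu0sq D.a (k + 1) B) ψ :=
  eq365_at D (hk1 := hk1) hkK ha hL e' l' e B ψ fun A' => integrable_density335 (liftSucc D) hl hreg _ A'

/-- **(3.63) on the carrier from the printed density's integrability on `λ′ ≥ 0`**, e.g. whenever `δm²(e′, λ′) > 0` for all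
`e′` and all `λ′ ≥ 0` (then also at `λ′ = 0`): r12's `Step363R` for `E′ = genFn364C`, `E_{k+1}` = (3.35) at level `k + 1`.
[cite: Balaban1982Higgs1, (3.63)–(3.65) p.624] -/
theorem step363R_concrete_of_pos (hk1 : 1 ≤ k) (hkK : k < P.K) (ha : 0 < D.a) (hL : 1 < P.L) (e lam : ℝ) (nbar : ℕ)
    (B : HiggsLattice.VecField P (k + 1)) (ψ : HiggsLattice.ScalarField P (k + 1) N)
    (hdm : ∀ (e' l' : ℝ), 0 ≤ l' → 0 < l' ∨ 0 < D.dm2 e' l') :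
    B1Sect3Statements.Step363R (fun e' l' => genFn364C D e' l' e B ψ)
      (fun e' l' => (liftSucc D).genFn335C e' l' (e • topPiece D.mu0sq D.a (k + 1) B) ψ)
      (siteInner (toSite B) (HiggsFluctMeasure.deltaK P D.mu0sq D.a (k + 1) (toSite B))) e lam nbar :=
  step363R_concrete D (hk1 := hk1) hkK ha hL e lam nbar B ψ fun e' l' hl' A' =>
    integrable_density335 (liftSucc D) hl' (hdm e' l' hl') _ A'

end Integrable

end Literature.MathematicalPhysics.QuantumFieldTheory.Balaban1983to89.B1Eq365Concrete
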